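import Summits.CriticalPhenomena.PercolationContinuityZ3.Theorems.Transplant.FKDoubleFanTwoSidedConeS
import Summits.CriticalPhenomena.PercolationContinuityZ3.Theorems.Transplant.FKDoubleFanOneSidedConeABS
import HarnessLib

/-!
# Double fans `K₂ ∨ P_{m+1}`: the DRESSED two-sided cone ("depth 1½") — single-fan images and their FIRST opposite spoke — and the
# reduction of the far cross-apex theorem (all middles) to ONE closure statement: a rim step after the first opposite spoke

Helper file (`--supports stmt-CriticalPhenomena-4575`), FK sub-lane `prim-bschramm-fk-3` (gen 42); builds on p205010 (kernel theorem, internal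
audit signed; external expert review pending).  No named facts, no sorries; standard axioms.  Memo `bschramm/prim-bschramm-fk-3/FAR-CROSS-XVII.md` §0(D).

Context.  `…TwoSidedConeSRefuted` (this gen) shows that the closed cone generated by all single-fan images is not letter-stable at any `q < 1`:
"rim step, then BOTH spokes" leaves it.  The guarded numerics of the memo show, on the other hand, that every tested word image lies in the cone
generated by the single-fan images TOGETHER WITH THEIR FIRST OPPOSITE SPOKE, `∧²AC_x·imgB q G w` and `∧²BC_y·imgA q F w` — the generators of
**`cone15 q`** below (bi-dual **`DualS15`** over the relaxation `InS`).  This file records the exact logical status of that observation: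
* the four generator families pair `≥ 0` with EVERY target — for the dressed ones because a spoke transports a target to a target
  (`⟪∧²AC_x·imgB G w, γ_s⟫ = ⟪imgB G w, γ_{AC_x ∗ s}⟫`, `⟪∧²BC_y·imgA F w, γ_s⟫ = (1−y)⟪imgA F w, γ_s⟫`), so **`target_dualS15`** holds
  UNCONDITIONALLY (LEMMA′ and its mirror on the relaxation, `target_tsDualS`);
* `cone15 q` is stable under `∧²AC_x`, `∧²BC_y` for free (spokes compose / commute: **`opAC_opAC`**, `opAC_opBC`, `opBC_opBC`), and under the rim step
  `∧²E_r` exactly if the two closure statements **`Hyp15A q`**: `∧²E_r ∧²AC_x·imgB q G w ∈ cone15 q` and **`Hyp15B q`**: `∧²E_r ∧²BC_y·imgA q F w ∈ cone15 q`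
  hold (**`isLetterCone_cone15`**);
* hence (**`rayleigh_crossFar_of_hyp15`**, **`negCorr_spokes_cross_far_of_hyp15`**): `Hyp15A q ∧ Hyp15B q` at `q ∈ (0,1]` ⟹
  `φ(J_{ac_j} ∩ J_{bc_k}) ≤ φ(J_{ac_j})φ(J_{bc_k})` for every weighted double fan and all `j < k` — NO positivity lemma beyond LEMMA′ is needed
  (in contrast to `…OneSidedDominance`/`…TwoSidedConeS`, whose closure hypotheses are refuted, and to the depth-2 route, which would also need LEMMA‴-BA).
STATUS OF `Hyp15A/B`: OPEN; conjectural; supported only by the guarded membership numerics of the memo (kit j287193/j287199/j287222, `depth2.py`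
letter mode) — NOT to be built upon with certificate files before the memo's test protocol (r→1 exit scans over all light rests, 3-leg product-form
LP) is clean.  "A rim step after the first opposite spoke is dominated by configurations with at most one opposite spoke and no later rim step."
[folklore]
-/

noncomputable section

namespace Summit.CriticalPhenomena.PercolationContinuityZ3.Theorems

namespace FK

namespace ThreeApex

/-! ### Spoke composition -/

/-- Two `a`-spokes at one vertex are one `a`-spoke: `∧²AC_x ∧²AC_{x'} = ∧²AC_{x + x' − xx'}`. [folklore] -/
theorem opAC_opAC (x x' : ℝ) (β : Biv) : opAC x (opAC x' β) = opAC (x + x' - x * x') β := by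
  ext <;> simp only [opAC, opTa, opWa, Biv.lin3, Biv.add, Biv.smul] <;> ring

/-! ### The dressed two-sided dual and bi-dual over `InS` -/

/-- The dual of the DRESSED two-sided images over the relaxation: bivectors pairing `≥ 0` with every `imgA q F w`, every `imgB q G w`,
every `∧²AC_x·imgB q G w` and every `∧²BC_y·imgA q F w` (`F, G, w ∈ InS q`, `x, y ∈ [0,1]`). [folklore] -/
def DualS15 (q : ℝ) (γ : Biv) : Prop :=
  TSDualS q γ ∧ (∀ (G w : V5) (x : ℝ), InS q G → InS q w → 0 ≤ x → x ≤ 1 → 0 ≤ pairH q (opAC x (imgB q G w)) γ) ∧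
    (∀ (F w : V5) (y : ℝ), InS q F → InS q w → 0 ≤ y → y ≤ 1 → 0 ≤ pairH q (opBC y (imgA q F w)) γ)

/-- **The dressed two-sided cone** ("depth 1½"): the closed convex cone bi-dual to the single-fan images and their first opposite spoke. [folklore] -/
def cone15 (q : ℝ) : Set Biv := {β | ∀ γ : Biv, DualS15 q γ → 0 ≤ pairH q β γ}

/-- `a`-images lie in the dressed cone. [folklore] -/
theorem imgA_mem_cone15 {q : ℝ} {F w : V5} (hF : InS q F) (hw : InS q w) : imgA q F w ∈ cone15 q :=
  fun _ hγ => hγ.1.1 F w hF hw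

/-- `b`-images lie in the dressed cone. [folklore] -/
theorem imgB_mem_cone15 {q : ℝ} {G w : V5} (hG : InS q G) (hw : InS q w) : imgB q G w ∈ cone15 q :=
  fun _ hγ => hγ.1.2 G w hG hw

/-- `a`-dressed `b`-images lie in the dressed cone. [folklore] -/
theorem opAC_imgB_mem_cone15 {q : ℝ} {G w : V5} {x : ℝ} (hG : InS q G) (hw : InS q w) (hx0 : 0 ≤ x) (hx1 : x ≤ 1) :
    opAC x (imgB q G w) ∈ cone15 q :=
  fun _ hγ => hγ.2.1 G w x hG hw hx0 hx1

/-- `b`-dressed `a`-images lie in the dressed cone. [folklore] -/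
theorem opBC_imgA_mem_cone15 {q : ℝ} {F w : V5} {y : ℝ} (hF : InS q F) (hw : InS q w) (hy0 : 0 ≤ y) (hy1 : y ≤ 1) :
    opBC y (imgA q F w) ∈ cone15 q :=
  fun _ hγ => hγ.2.2 F w y hF hw hy0 hy1

/-- The dressed cone contains the two-sided cone `tsConeS q` of `…TwoSidedConeS`. [folklore] -/
theorem tsConeS_subset_cone15 (q : ℝ) : tsConeS q ⊆ cone15 q :=
  fun _ hβ γ hγ => hβ γ hγ.1

/-- **Inputs lie in the dressed cone** (`u ∈ InKE q`, `0 < q ≤ 1`). [folklore] -/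
theorem input_mem_cone15 {q : ℝ} (hq0 : 0 < q) (hq1 : q ≤ 1) {u : V5} (hu : InKE q u) :
    wedgeH (conv (edgeAC 0) u) (conv (edgeAC 1) u) ∈ cone15 q :=
  tsConeS_subset_cone15 q (input_mem_tsConeS hq0 hq1 hu)

/-- **`Hyp15A`**: a rim step after the first `a`-spoke on a `b`-image stays in the dressed cone. [folklore] -/
def Hyp15A (q : ℝ) : Prop :=
  ∀ (G w : V5) (x r : ℝ), InS q G → InS q w → 0 ≤ x → x ≤ 1 → 0 ≤ r → r ≤ 1 → opE q r (opAC x (imgB q G w)) ∈ cone15 q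

/-- **`Hyp15B`**: a rim step after the first `b`-spoke on an `a`-image stays in the dressed cone. [folklore] -/
def Hyp15B (q : ℝ) : Prop :=
  ∀ (F w : V5) (y r : ℝ), InS q F → InS q w → 0 ≤ y → y ≤ 1 → 0 ≤ r → r ≤ 1 → opE q r (opBC y (imgA q F w)) ∈ cone15 q

namespace DualS15

variable {q : ℝ} {γ : Biv}

/-- The dressed dual is stable under rim steps, GIVEN `Hyp15A ∧ Hyp15B` (`0 < q ≤ 1`). [folklore] -/
theorem rim (hq0 : 0 < q) (hq1 : q ≤ 1) (hγ : DualS15 q γ) (hA : Hyp15A q) (hB : Hyp15B q) {r : ℝ} (hr0 : 0 ≤ r) (hr1 : r ≤ 1) :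
    DualS15 q (opE q r γ) := by
  refine ⟨hγ.1.rim hq0 hq1 hr0 hr1, fun G w x hG hw hx0 hx1 => ?_, fun F w y hF hw hy0 hy1 => ?_⟩
  · rw [← pairH_opE]; exact hA G w x r hG hw hx0 hx1 hr0 hr1 γ hγ
  · rw [← pairH_opE]; exact hB F w y r hF hw hy0 hy1 hr0 hr1 γ hγ

/-- The dressed dual is stable under `a`-spokes (unconditionally; `0 < q ≤ 1`). [folklore] -/
theorem ac (hq0 : 0 < q) (hq1 : q ≤ 1) (hγ : DualS15 q γ) {x : ℝ} (hx0 : 0 ≤ x) (hx1 : x ≤ 1) : DualS15 q (opAC x γ) := by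
  refine ⟨⟨fun F w hF hw => ?_, fun G w hG hw => ?_⟩, fun G w x' hG hw hx0' hx1' => ?_, fun F w y hF hw hy0 hy1 => ?_⟩
  · rw [← pairH_opAC, opAC_imgA]; exact hγ.1.1 _ _ (hF.step hq0 hq1 (IsLetter.bc hx0 hx1)) hw
  · rw [← pairH_opAC]; exact hγ.2.1 G w x hG hw hx0 hx1
  · rw [← pairH_opAC, opAC_opAC]
    have h0 : 0 ≤ x + x' - x * x' := by nlinarith [mul_nonneg (sub_nonneg.2 hx1) hx0']
    have h1 : x + x' - x * x' ≤ 1 := by nlinarith [mul_nonneg (sub_nonneg.2 hx1) (sub_nonneg.2 hx1')]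
    exact hγ.2.1 G w _ hG hw h0 h1
  · rw [← pairH_opAC, opAC_opBC, opAC_imgA]; exact hγ.2.2 _ w y (hF.step hq0 hq1 (IsLetter.bc hx0 hx1)) hw hy0 hy1

/-- The dressed dual is stable under `b`-spokes (unconditionally; `0 < q ≤ 1`). [folklore] -/
theorem bc (hq0 : 0 < q) (hq1 : q ≤ 1) (hγ : DualS15 q γ) {y : ℝ} (hy0 : 0 ≤ y) (hy1 : y ≤ 1) : DualS15 q (opBC y γ) := by
  refine ⟨⟨fun F w hF hw => ?_, fun G w hG hw => ?_⟩, fun G w x hG hw hx0 hx1 => ?_, fun F w y' hF hw hy0' hy1' => ?_⟩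
  · rw [← pairH_opBC]; exact hγ.2.2 F w y hF hw hy0 hy1
  · rw [← pairH_opBC, opBC_imgB]; exact hγ.1.2 _ _ (hG.step hq0 hq1 (IsLetter.bc hy0 hy1)) hw
  · rw [← pairH_opBC, ← opAC_opBC, opBC_imgB]; exact hγ.2.1 _ w x (hG.step hq0 hq1 (IsLetter.bc hy0 hy1)) hw hx0 hx1
  · rw [← pairH_opBC, opBC_opBC]
    have h0 : 0 ≤ y + y' - y * y' := by nlinarith [mul_nonneg (sub_nonneg.2 hy1) hy0']
    have h1 : y + y' - y * y' ≤ 1 := by nlinarith [mul_nonneg (sub_nonneg.2 hy1) (sub_nonneg.2 hy1')]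
    exact hγ.2.2 F w _ hF hw h0 h1

end DualS15

/-- **Under `Hyp15A ∧ Hyp15B` the dressed cone is a letter cone** (`0 < q ≤ 1`). [folklore] -/
theorem isLetterCone_cone15 {q : ℝ} (hq0 : 0 < q) (hq1 : q ≤ 1) (hA : Hyp15A q) (hB : Hyp15B q) : IsLetterCone q (cone15 q) where
  zero_mem := fun γ _ => le_of_eq (pairH_zero_left q γ).symm
  add_mem := fun β γ hβ hγ δ hδ => by rw [pairH_add_left]; exact add_nonneg (hβ δ hδ) (hγ δ hδ)
  smul_mem := fun a β ha hβ δ hδ => by rw [pairH_smul_left]; exact mul_nonneg ha (hβ δ hδ)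
  rim := fun r β hr0 hr1 hβ γ hγ => by rw [pairH_opE]; exact hβ _ (hγ.rim hq0 hq1 hA hB hr0 hr1)
  ac := fun x β hx0 hx1 hβ γ hγ => by rw [pairH_opAC]; exact hβ _ (hγ.ac hq0 hq1 hx0 hx1)
  bc := fun y β hy0 hy1 hβ γ hγ => by rw [pairH_opBC]; exact hβ _ (hγ.bc hq0 hq1 hy0 hy1)

/-! ### Targets lie in the dressed dual — unconditionally -/

/-- An `a`-spoke transports a target to the target of the extended suffix: `∧²AC_x((s∗BC_0)∧(s∗BC_1)) = ((AC_x∗s)∗BC_0)∧((AC_x∗s)∗BC_1)`. [folklore] -/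
theorem opAC_target (x : ℝ) (s : V5) :
    opAC x (wedgeH (conv s (edgeBC 0)) (conv s (edgeBC 1))) =
      wedgeH (conv (conv (edgeAC x) s) (edgeBC 0)) (conv (conv (edgeAC x) s) (edgeBC 1)) := by
  have e : ∀ τ : ℝ, conv (edgeAC x) (conv s (edgeBC τ)) = conv (conv (edgeAC x) s) (edgeBC τ) := by
    intro τ; simp only [← mul_def]; ac_rfl
  rw [opAC_wedgeH, e, e]

/-- **Every target lies in the dressed dual** (`0 < q < 1`, `s ∈ InKE q`): LEMMA′ and its mirror on the relaxation, transported by one spoke. [folklore] -/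
theorem target_dualS15 {q : ℝ} (hq0 : 0 < q) (hq1 : q < 1) {s : V5} (hs : InKE q s) :
    DualS15 q (wedgeH (conv s (edgeBC 0)) (conv s (edgeBC 1))) := by
  refine ⟨target_tsDualS hq0 hq1 hs, fun G w x hG hw hx0 hx1 => ?_, fun F w y hF hw hy0 hy1 => ?_⟩
  · rw [pairH_opAC, opAC_target]
    exact (target_tsDualS hq0 hq1 (InKE.step (IsLetter.ac hx0 hx1) hs)).2 G w hG hw
  · rw [pairH_opBC, opBC_target, pairH_comm, pairH_smul_left, pairH_comm]
    exact mul_nonneg (sub_nonneg.2 hy1) ((target_tsDualS hq0 hq1 hs).1 F w hF hw)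

/-- The dressed cone pairs non-negatively with every target (`0 < q < 1`). [folklore] -/
theorem pairH_cone15_target {q : ℝ} (hq0 : 0 < q) (hq1 : q < 1) {s : V5} (hs : InKE q s) :
    ∀ β, β ∈ cone15 q → 0 ≤ pairH q β (wedgeH (conv s (edgeBC 0)) (conv s (edgeBC 1))) :=
  fun _ hβ => hβ _ (target_dualS15 hq0 hq1 hs)

/-! ### The reduction: `Hyp15A ∧ Hyp15B` ⟹ the far cross-apex pair for every middle -/

/-- **`Hyp15A ∧ Hyp15B` ⟹ THE ALGEBRA-LEVEL FAR THEOREM** (`0 < q ≤ 1`): the hypothesis `halg` of `negCorr_spokes_cross_far_of_inKE`. [folklore] -/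
theorem rayleigh_crossFar_of_hyp15 {q : ℝ} (hq0 : 0 < q) (hq1 : q ≤ 1) (hA : Hyp15A q) (hB : Hyp15B q) :
    ∀ (mids : List (ℝ × ℝ × ℝ)), UnitBlocks mids → ∀ rd : ℝ, 0 ≤ rd → rd ≤ 1 → ∀ u s : V5, InKE q u → InKE q s →
      0 ≤ crossFarZ q mids rd u s 1 0 * crossFarZ q mids rd u s 0 1 - crossFarZ q mids rd u s 1 1 * crossFarZ q mids rd u s 0 0 := by
  intro mids hm rd hrd0 hrd1 u s hu hs
  rcases eq_or_lt_of_le hq1 with h1 | h1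
  · subst h1; rw [rayleigh_crossFar_one]
  · have key := rayleigh_crossFar_of_isLetterCone (isLetterCone_cone15 hq0 hq1 hA hB) hm hrd0 hrd1 (input_mem_cone15 hq0 hq1 hu)
      (pairH_cone15_target hq0 h1 hs)
    simp only [crossFarZ]
    linarith [key]

open MeasureTheory Literature.Probability.LatticeModels Literature.Probability.Percolation
open scoped Classical

variable {V : Type*} [Fintype V]

section Setting

variable {a b : V} {c : ℕ → V} {m : ℕ}
variable (hab : a ≠ b) (hinj : ∀ j k, j ≤ m → k ≤ m → c j = c k → j = k) (hca : ∀ j, j ≤ m → c j ≠ a) (hcb : ∀ j, j ≤ m → c j ≠ b)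
include hab hinj hca hcb

/-- **`Hyp15A ∧ Hyp15B` ⟹ NEGATIVE CORRELATION OF EVERY CROSS-APEX PAIR AT EVERY DISTANCE.**  If the two dressed closure statements hold at
`q ∈ (0,1]`, then for every weighted double fan (`card V = m + 3`, weights supported on the double-fan pairs) and all `j < k ≤ m`:
`φ(J_{a c_j} ∩ J_{b c_k}) ≤ φ(J_{a c_j})·φ(J_{b c_k})`. [folklore] -/
theorem negCorr_spokes_cross_far_of_hyp15 (hcard : Fintype.card V = m + 3) {q : ℝ} (hq0 : 0 < q) (hq1 : q ≤ 1)
    (w : Sym2 V → unitInterval) (hsupp : ∀ e, e ∉ dfPairs a b c m → w e = 0) (hA : Hyp15A q) (hB : Hyp15B q)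
    {j k : ℕ} (hjk : j < k) (hk : k ≤ m) :
    (rcMeasureW w q ∅).real ({ω : BondConfig V | s(a, c j) ∈ ω} ∩ {ω | s(b, c k) ∈ ω}) ≤
      (rcMeasureW w q ∅).real {ω : BondConfig V | s(a, c j) ∈ ω} * (rcMeasureW w q ∅).real {ω : BondConfig V | s(b, c k) ∈ ω} :=
  negCorr_spokes_cross_far_of_inKE hab hinj hca hcb hcard hq0 w hsupp (rayleigh_crossFar_of_hyp15 hq0 hq1 hA hB) hjk hk

end Setting

end ThreeApex

end FK

end Summit.CriticalPhenomena.PercolationContinuityZ3.Theorems
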